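import Literature.NumberTheory.Automorphic.HidaIndependenceOfWeightGL2
import Literature.NumberTheory.Automorphic.LevelActionTrivialOnLevel
import HarnessLib

/-!
# Independence of weight on the Hida tower `H^•(X_{U(b,c)}, S)` of `GL₂`

Topic `NumberTheory/Automorphic`; namespace `Literature.NumberTheory.Automorphic.BigHeckeGLn`;
theorems only.  The statement of **independence of weight** ([KhareThorne2017, §6.4, Prop. 6.13];
[Hida1994AIF, §2, Prop. 2.1]) in the vocabulary of the named fact
`hidaControl_dominantOrdinaryPoint` (the arithmetic-quotient cohomology
`ArithmeticQuotient.cohomology S ι (𝒰.level b c) S i = H^i(X_{U(b,c)}, S)` of the Hida tower with its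
Hecke operators `heckeEnd`), assembled from `HidaIndependenceOfWeightGL2` (the bijection
`(λ₁)_* : H^i(U, Sym^m(S²))^{ord} → H^i(U, S(χ_m))^{ord}` in the level-action model) and
`LevelActionTrivialOnLevel` (`H^i(U, S(χ_m)) ≅ H^i(X_U, S)` when `χ_m|_U = 1`):

* `lowChar_eq_of_mem_doubleCosetQuot`, `lowChar_heckeElement_pow`,
  `lowChar_eq_one_of_localComponent_eq_one`, `lowChar_diamondElement` — the character `χ_m` along
  the double cosets of `U_v^r` (`= 1`), of elements trivial at `v` (`= 1`: `T_w`, `U_{v'}`, `⟨u⟩_{v'}`)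
  and of the diamonds `⟨u⟩_v` (`= red(u₁)^m`);
* `TameLevel.lowChar_eq_one_of_mem_level` — `χ_m ≡ 1` on `U(b,c)` as soon as `red` kills the closed
  ball of radius `|ϖ_v|^b` (e.g. `red : 𝒪_v → 𝒪_v/ϖ^r`, `r ≤ b ≤ c`);
* `TameLevel.independenceOfWeight_bijOn_level` — **for finite cohomology groups, the composite
  `H^i(U(b,c), Sym^m(S²)) →(λ₁)_*→ H^i(U(b,c), S(χ_m)) ≅ H^i(X_{U(b,c)}, S)` is a bijection between the
  `U_v^r`-ordinary parts `⋂ₙ range (U_v^r)ⁿ`**, where on the target `U_v^r = heckeEnd (t_{v,1}^r)` is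
  the Hecke operator of the tree's Hida tower (`TameLevel.level_heckeCohomology_comp`: the
  comparison is `[U t_{v,1}^r U]`-equivariant);
* `TameLevel.level_(pushforward_)heckeCohomology_comp_of_localComponent_eq_one`,
  `TameLevel.level_heckeCohomology_comp_diamondElement` — equivariance of the comparison for the
  Hecke elements trivial at `v` (`T_w`, `U_{v'}`, `⟨u⟩_{v'}`) and the twisted equivariance
  `⟨u⟩_v ↦ χ_m(⟨u⟩_v) ⟨u⟩_v`, `χ_m(⟨u⟩_v) = red(u₁)^m`, for the diamonds at `v`.

## References

* C. Khare, J. A. Thorne, *Potential automorphy and the Leopoldt conjecture*, Amer. J. Math. 139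
  (2017), §6.4, Prop. 6.13 (arXiv:1409.7007, held; read 2026-08-16). [KhareThorne2017]
* H. Hida, *p-adic ordinary Hecke algebras for GL(2)*, Ann. Inst. Fourier 44 (1994), §2, Prop. 2.1
  (held). [Hida1994AIF]
-/

noncomputable section

open CategoryTheory IsDedekindDomain NumberField

namespace Literature.NumberTheory.Automorphic

/-! ### A linear equivalence intertwining two operators exchanges their ordinary parts -/

section Generic

variable {R : Type*} [Semiring R] {V W : Type*} [AddCommMonoid V] [AddCommMonoid W] [Module R V]
  [Module R W]

/-- **A linear equivalence `e` with `e U = U' e` is a bijection `⋂ₙ range Uⁿ ≃ ⋂ₙ range U'ⁿ`.**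
[folklore] -/
theorem bijOn_iInf_range_pow_of_linearEquiv (e : V ≃ₗ[R] W) {U : Module.End R V} {U' : Module.End R W}
    (h : (e : V →ₗ[R] W) ∘ₗ U = U' ∘ₗ (e : V →ₗ[R] W)) :
    Set.BijOn e (⨅ n : ℕ, LinearMap.range (U ^ n) : Submodule R V)
      (⨅ n : ℕ, LinearMap.range (U' ^ n) : Submodule R W) := by
  have h' : (e.symm : W →ₗ[R] V) ∘ₗ U' = U ∘ₗ (e.symm : W →ₗ[R] V) := by
    refine LinearMap.ext fun w => ?_
    apply e.injective
    have := LinearMap.congr_fun h (e.symm w)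
    simp only [LinearMap.coe_comp, Function.comp_apply, LinearEquiv.coe_coe,
      LinearEquiv.apply_symm_apply] at this ⊢
    exact this.symm
  refine ⟨BigHeckeGLn.mapsTo_iInf_range_pow_of_comp_eq h, fun _ _ _ _ hxy => e.injective hxy,
    fun w hw => ⟨e.symm w, BigHeckeGLn.mapsTo_iInf_range_pow_of_comp_eq h' hw, e.apply_symm_apply w⟩⟩

end Generic

namespace IntegralWeightGL2

open BigHeckeGLn LevelAction

variable {K : Type} [Field K] [NumberField K] {v : HeightOneSpectrum (𝓞 K)} {S : Type} [CommRing S]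
  (red : v.adicCompletionIntegers K →+* S)

/-! ### The character `χ_m` on Hecke elements -/

/-- **`χ_m` is constant along a double coset `U α U` on which it is trivial on `U`.** [folklore] -/
theorem lowChar_eq_of_mem_doubleCosetQuot (m : ℕ) {U : Subgroup (FiniteAdelicGL 2 K)}
    (hU : U.toSubmonoid ≤ iwahoriMonoid K v red)
    (hχ : ∀ (u : FiniteAdelicGL 2 K) (hu : u ∈ U), lowChar K v red m ⟨u, hU hu⟩ = 1)
    {α : FiniteAdelicGL 2 K} (hα : α ∈ iwahoriMonoid K v red) {y : FiniteAdelicGL 2 K}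
    (hy : y ∈ iwahoriMonoid K v red)
    (hyd : (y : FiniteAdelicGL 2 K ⧸ U) ∈ ArithmeticQuotient.doubleCosetQuot U α) :
    lowChar K v red m ⟨y, hy⟩ = lowChar K v red m ⟨α, hα⟩ := by
  obtain ⟨u, hu, huy⟩ := exists_mk_eq_of_mem_doubleCosetQuot hyd
  have hu' : (u * α)⁻¹ * y ∈ U := QuotientGroup.eq.1 huy
  have hy_eq : (⟨y, hy⟩ : iwahoriMonoid K v red) =
      ⟨u, hU hu⟩ * ⟨α, hα⟩ * ⟨(u * α)⁻¹ * y, hU hu'⟩ :=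
    Subtype.ext (by simp [mul_assoc])
  rw [hy_eq, map_mul, map_mul, hχ u hu, hχ _ hu', one_mul, mul_one]

/-- `χ_m(α) = red((α_v)₁₁)^m` as an endomorphism: it is `1` as soon as `red((α_v)₁₁) = 1`. [folklore] -/
theorem lowChar_eq_one_of_redMatrix_one_one (m : ℕ) {α : iwahoriMonoid K v red}
    (h : redMatrix K v red α 1 1 = 1) : lowChar K v red m α = 1 := by
  refine LinearMap.ext fun c => ?_
  rw [lowChar_apply, h, one_pow, one_mul, Module.End.one_apply]

/-- **`χ_m(α) = 1` for `α` trivial at `v`** (the Hecke elements `t_{w,j}`, `w ≠ v`, the diamonds at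
other places, `GL₂(K_w)`). [folklore] -/
theorem lowChar_eq_one_of_localComponent_eq_one (m : ℕ) {α : FiniteAdelicGL 2 K}
    (hα : α ∈ iwahoriMonoid K v red) (h1 : localComponent 2 K v α = 1) :
    lowChar K v red m ⟨α, hα⟩ = 1 := by
  refine lowChar_eq_one_of_redMatrix_one_one red m ?_
  have h : toIntMatrix K 2 v (localInt K v red ⟨α, hα⟩) 1 1 = 1 :=
    Subtype.ext (by
      rw [coe_toIntMatrix_localInt_apply]
      change ((localComponent 2 K v α : GL (Fin 2) (v.adicCompletion K)) :
        Matrix (Fin 2) (Fin 2) (v.adicCompletion K)) 1 1 = _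
      rw [h1, Units.val_one, Matrix.one_apply_eq]
      rfl)
  rw [redMatrix_apply, h, map_one]

/-- **`χ_m(t_{v,1}^r) = 1`** (`(t_{v,1}^r)_v = diag(ϖ^r, 1)`). [folklore] -/
theorem lowChar_heckeElement_pow (m r : ℕ) :
    lowChar K v red m ⟨heckeElement 2 K v 1 ^ r, heckeElement_pow_mem_iwahoriMonoid K v red r⟩ = 1 := by
  refine lowChar_eq_one_of_redMatrix_one_one red m ?_
  have h : toIntMatrix K 2 v (localInt K v red
      ⟨heckeElement 2 K v 1 ^ r, heckeElement_pow_mem_iwahoriMonoid K v red r⟩) 1 1 = 1 :=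
    Subtype.ext (by
      rw [coe_toIntMatrix_localInt_apply]
      exact (coe_localComponent_heckeElement_one_pow_apply K v r 1 1).trans (by simp))
  rw [redMatrix_apply, h, map_one]

/-- **`χ_m ≡ 1` along the double coset of `U_v^r = [U t_{v,1}^r U]`** (for `χ_m|_U = 1`). [folklore] -/
theorem lowChar_eq_one_of_mem_doubleCosetQuot_heckeElement_pow (m r : ℕ)
    {U : Subgroup (FiniteAdelicGL 2 K)} (hU : U.toSubmonoid ≤ iwahoriMonoid K v red)
    (hχ : ∀ (u : FiniteAdelicGL 2 K) (hu : u ∈ U), lowChar K v red m ⟨u, hU hu⟩ = 1)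
    (y : FiniteAdelicGL 2 K) (hy : y ∈ iwahoriMonoid K v red)
    (hyd : (y : FiniteAdelicGL 2 K ⧸ U) ∈
      ArithmeticQuotient.doubleCosetQuot U (heckeElement 2 K v 1 ^ r)) :
    lowChar K v red m ⟨y, hy⟩ = 1 := by
  rw [lowChar_eq_of_mem_doubleCosetQuot red m hU hχ (heckeElement_pow_mem_iwahoriMonoid K v red r) hy hyd,
    lowChar_heckeElement_pow]

/-- The diamond element `⟨u⟩_v` lies in the Iwahori monoid (diagonal, integral). [folklore] -/
theorem diamondElement_mem_iwahoriMonoid (u : Fin 2 → (v.adicCompletionIntegers K)ˣ) :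
    diamondElement 2 K v u ∈ iwahoriMonoid K v red := by
  refine ⟨fun i j => ?_, 0, map_zero red, ?_⟩
  · rw [diamondElement_apply, localComponent_ofLocal, coe_glDiagonal, Matrix.diagonal_apply]
    split_ifs
    · exact (HeightOneSpectrum.mem_adicCompletionIntegers (R := 𝓞 K) K v).2
        (le_of_eq (valued_unitsToLocal v u i))
    · exact zero_mem _
  · rw [diamondElement_apply, localComponent_ofLocal, coe_glDiagonal,
      Matrix.diagonal_apply_ne _ (by decide)]
    rfl

/-- **`χ_m(⟨u⟩_v) = red(u₁)^m`** — the slot-`1` diamond twist. [cite: KhareThorne2017, §6.4] -/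
theorem lowChar_diamondElement_apply (m : ℕ) (u : Fin 2 → (v.adicCompletionIntegers K)ˣ) (c : S) :
    lowChar K v red m ⟨diamondElement 2 K v u, diamondElement_mem_iwahoriMonoid red u⟩ c =
      red ((u 1 : (v.adicCompletionIntegers K)ˣ) : v.adicCompletionIntegers K) ^ m * c := by
  rw [lowChar_apply, redMatrix_apply]
  congr 3
  refine Subtype.ext ?_
  rw [coe_toIntMatrix_localInt_apply]
  change ((localComponent 2 K v (diamondElement 2 K v u) : GL (Fin 2) (v.adicCompletion K)) :
    Matrix (Fin 2) (Fin 2) (v.adicCompletion K)) 1 1 = _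
  rw [diamondElement_apply, localComponent_ofLocal, coe_glDiagonal, Matrix.diagonal_apply_eq]
  rfl

end IntegralWeightGL2

namespace BigHeckeGLn

namespace TameLevel

open LevelAction IntegralWeightGL2

variable {K : Type} [Field K] [NumberField K] {p : ℕ} [Fact p.Prime] (𝒰 : TameLevel 2 K p)
  {v : HeightOneSpectrum (𝓞 K)} (hv : (p : 𝓞 K) ∈ v.asIdeal) {S : Type} [CommRing S]
  (red : v.adicCompletionIntegers K →+* S) {b c : ℕ} (hbc : b ≤ c)
  (hred : ∀ x : v.adicCompletionIntegers K,
    Valued.v (x : v.adicCompletion K) ≤ (WithZero.exp (-(b : ℤ)) : WithZero (Multiplicative ℤ)) →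
      red x = 0)

include hbc hred in
/-- From `b ≤ c`: `red` kills the closed ball of radius `|ϖ_v|^c` too. [folklore] -/
theorem red_eq_zero_of_valued_le_exp_neg
    (x : v.adicCompletionIntegers K)
    (hx : Valued.v (x : v.adicCompletion K) ≤ (WithZero.exp (-(c : ℤ)) : WithZero (Multiplicative ℤ))) :
    red x = 0 :=
  hred x (hx.trans (WithZero.exp_le_exp.2 (neg_le_neg (Int.ofNat_le.2 hbc))))

include hv hbc hred in
/-- `U(b,c)` lies in the Iwahori monoid modulo `ker red` (radius-`b` hypothesis, `b ≤ c`). [folklore] -/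
theorem level_le_iwahoriMonoid' : (𝒰.level b c).toSubmonoid ≤ iwahoriMonoid K v red :=
  𝒰.level_le_iwahoriMonoid red hv (red_eq_zero_of_valued_le_exp_neg red hbc hred)

/-- **`χ_m ≡ 1` on `U(b,c)`** when `red` kills the closed ball of radius `|ϖ_v|^b`: the diagonal
entries of `u_v` are `≡ 1 (mod ϖ_v^b)`. [cite: KhareThorne2017, §6.4] -/
theorem lowChar_eq_one_of_mem_level (m : ℕ) (u : FiniteAdelicGL 2 K) (hu : u ∈ 𝒰.level b c) :
    lowChar K v red m ⟨u, 𝒰.level_le_iwahoriMonoid' hv red hbc hred hu⟩ = 1 := by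
  refine lowChar_eq_one_of_redMatrix_one_one red m ?_
  have hloc := ((𝒰.mem_level_iff b c u).1 hu).2 v hv
  have h := (mem_valuedIwahoriSubgroup_iff.1 hloc).1
  set e : v.adicCompletionIntegers K :=
    toIntMatrix K 2 v (localInt K v red ⟨u, 𝒰.level_le_iwahoriMonoid' hv red hbc hred hu⟩) 1 1 with he
  have hsub : red (e - 1) = 0 := by
    refine hred _ ?_
    have : ((e - 1 : v.adicCompletionIntegers K) : v.adicCompletion K) =
        ((localComponent 2 K v u : GL (Fin 2) (v.adicCompletion K)) :
          Matrix (Fin 2) (Fin 2) (v.adicCompletion K)) 1 1 - 1 := by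
      push_cast
      rw [he, coe_toIntMatrix_localInt_apply]
    rw [this]
    exact h.diag 1
  rw [redMatrix_apply, ← he]
  rw [map_sub, map_one, sub_eq_zero] at hsub
  exact hsub

/-! ### Independence of weight on `H^i(X_{U(b,c)}, S)` -/

variable {Γ : Type} [Group Γ] (ι : Γ →* FiniteAdelicGL 2 K) (m r : ℕ) (i : ℕ)

/-- **The comparison `H^i(U(b,c), S(χ_m)) ≅ H^i(X_{U(b,c)}, S)` is `U_v^r`-equivariant**:
`Φ_* ∘ [U t_{v,1}^r U] = heckeEnd (t_{v,1}^r) ∘ Φ_*` (no twist: `χ_m ≡ 1` along the double coset).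
[cite: KhareThorne2017, §6.4] -/
theorem level_heckeCohomology_comp :
    (cohomologyIso ι (iwahoriMonoid K v red) (lowChar K v red m) (𝒰.level b c)
        (𝒰.level_le_iwahoriMonoid' hv red hbc hred) (𝒰.lowChar_eq_one_of_mem_level hv red hbc hred m) i).hom.hom ∘ₗ
      heckeCohomology ι (iwahoriMonoid K v red) (lowChar K v red m) (𝒰.level b c)
        (𝒰.level_le_iwahoriMonoid' hv red hbc hred) (heckeElement_pow_mem_iwahoriMonoid K v red r) i =
      ArithmeticQuotient.heckeEnd S (𝒰.level b c) (heckeElement 2 K v 1 ^ r) S ι i ∘ₗ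
        (cohomologyIso ι (iwahoriMonoid K v red) (lowChar K v red m) (𝒰.level b c)
          (𝒰.level_le_iwahoriMonoid' hv red hbc hred) (𝒰.lowChar_eq_one_of_mem_level hv red hbc hred m) i).hom.hom :=
  heckeCohomology_comp_cohomologyIso_hom_of_eq_one ι _ _ (heckeElement_pow_mem_iwahoriMonoid K v red r)
    (lowChar_eq_one_of_mem_doubleCosetQuot_heckeElement_pow red m r _
      (𝒰.lowChar_eq_one_of_mem_level hv red hbc hred m)) i

/-- **Independence of weight on the Hida tower (finite coefficients, one place above `p`).**
For `b ≤ c`, `red : 𝒪_v → S` killing the closed ball of radius `|ϖ_v|^b` and with `red(ϖ_v)^r = 0`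
(e.g. `S = 𝒪_v/ϖ^r`, `r ≤ b`), and finite cohomology groups, the composite
`H^i(U(b,c), Sym^m(S²)) →(λ₁)_*→ H^i(U(b,c), S(χ_m)) ≅ H^i(X_{U(b,c)}, S)` restricts to a bijection
from the `U_v^r`-ordinary part `⋂ₙ range [U t_{v,1}^r U]ⁿ` of the weight-`Sym^m` cohomology onto the
`U_v^r`-ordinary part `⋂ₙ range (heckeEnd t_{v,1}^r)ⁿ` of the trivial-coefficient cohomology of the
tree's Hida tower. [cite: KhareThorne2017, §6.4, Prop. 6.13] [cite: Hida1994AIF, §2, Prop. 2.1] -/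
theorem independenceOfWeight_bijOn_level
    (hr : red ⟨_, uniformizerAt_mem_adicCompletionIntegers K v⟩ ^ r = 0)
    [Finite (cohomology ι (iwahoriMonoid K v red) (symPowCoeff K v red m) (𝒰.level b c) i)]
    [Finite (ArithmeticQuotient.cohomology S ι (𝒰.level b c) S i)] :
    Set.BijOn
      ((cohomologyIso ι (iwahoriMonoid K v red) (lowChar K v red m) (𝒰.level b c)
          (𝒰.level_le_iwahoriMonoid' hv red hbc hred) (𝒰.lowChar_eq_one_of_mem_level hv red hbc hred m) i).hom.hom ∘
        (pushforwardCohomology ι (iwahoriMonoid K v red) (symPowCoeff K v red m) (lowChar K v red m)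
          (𝒰.level b c) (coeffX₁ S m) (coeffX₁_comp_symPowCoeff m) i).hom)
      (⨅ n : ℕ, LinearMap.range (heckeCohomology ι (iwahoriMonoid K v red) (symPowCoeff K v red m)
        (𝒰.level b c) (𝒰.level_le_iwahoriMonoid' hv red hbc hred)
        (heckeElement_pow_mem_iwahoriMonoid K v red r) i ^ n) : Submodule S _)
      (⨅ n : ℕ, LinearMap.range
        (ArithmeticQuotient.heckeEnd S (𝒰.level b c) (heckeElement 2 K v 1 ^ r) S ι i ^ n) : Submodule S _) := by
  set e := cohomologyIso ι (iwahoriMonoid K v red) (lowChar K v red m) (𝒰.level b c)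
    (𝒰.level_le_iwahoriMonoid' hv red hbc hred) (𝒰.lowChar_eq_one_of_mem_level hv red hbc hred m) i with he_def
  haveI : Finite (cohomology ι (iwahoriMonoid K v red) (lowChar K v red m) (𝒰.level b c) i) :=
    Finite.of_equiv _ e.toLinearEquiv.symm.toEquiv
  have hiso := bijOn_iInf_range_pow_of_linearEquiv e.toLinearEquiv
    (U := heckeCohomology ι (iwahoriMonoid K v red) (lowChar K v red m) (𝒰.level b c)
      (𝒰.level_le_iwahoriMonoid' hv red hbc hred) (heckeElement_pow_mem_iwahoriMonoid K v red r) i)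
    (U' := ArithmeticQuotient.heckeEnd S (𝒰.level b c) (heckeElement 2 K v 1 ^ r) S ι i)
    (𝒰.level_heckeCohomology_comp hv red hbc hred ι m r i)
  exact hiso.comp (independenceOfWeight_bijOn_ordinaryPart red ι m
    (𝒰.level_le_iwahoriMonoid' hv red hbc hred) r i hr)

/-! ### Equivariance of the comparison for the other Hecke operators -/

/-- **Elements trivial at `v` act compatibly**: for `α` in the Iwahori monoid with `α_v = 1` (the
Hecke elements `t_{w,j}`, `w ≠ v`, the `U_{v'}` and diamonds at the other places above `p`),
`Φ_* ∘ [U α U] = heckeEnd α ∘ Φ_*` on `H^i(U(b,c), S(χ_m)) ≅ H^i(X_{U(b,c)}, S)`. [folklore] -/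
theorem level_heckeCohomology_comp_of_localComponent_eq_one {α : FiniteAdelicGL 2 K}
    (hα : α ∈ iwahoriMonoid K v red) (h1 : localComponent 2 K v α = 1) :
    (cohomologyIso ι (iwahoriMonoid K v red) (lowChar K v red m) (𝒰.level b c)
        (𝒰.level_le_iwahoriMonoid' hv red hbc hred) (𝒰.lowChar_eq_one_of_mem_level hv red hbc hred m) i).hom.hom ∘ₗ
      heckeCohomology ι (iwahoriMonoid K v red) (lowChar K v red m) (𝒰.level b c)
        (𝒰.level_le_iwahoriMonoid' hv red hbc hred) hα i =
      ArithmeticQuotient.heckeEnd S (𝒰.level b c) α S ι i ∘ₗ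
        (cohomologyIso ι (iwahoriMonoid K v red) (lowChar K v red m) (𝒰.level b c)
          (𝒰.level_le_iwahoriMonoid' hv red hbc hred) (𝒰.lowChar_eq_one_of_mem_level hv red hbc hred m) i).hom.hom :=
  heckeCohomology_comp_cohomologyIso_hom_of_eq_one ι _ _ hα (fun y hy hyd => by
    rw [lowChar_eq_of_mem_doubleCosetQuot red m _ (𝒰.lowChar_eq_one_of_mem_level hv red hbc hred m) hα hy hyd,
      lowChar_eq_one_of_localComponent_eq_one red m hα h1]) i

/-- The same for the composite with `(λ₁)_*`: **`(Φ_* ∘ (λ₁)_*) ∘ [U α U] = heckeEnd α ∘ (Φ_* ∘ (λ₁)_*)`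
from `H^i(U(b,c), Sym^m(S²))` to `H^i(X_{U(b,c)}, S)`** for `α_v = 1`. [folklore] -/
theorem level_pushforward_heckeCohomology_comp_of_localComponent_eq_one {α : FiniteAdelicGL 2 K}
    (hα : α ∈ iwahoriMonoid K v red) (h1 : localComponent 2 K v α = 1) :
    ((cohomologyIso ι (iwahoriMonoid K v red) (lowChar K v red m) (𝒰.level b c)
        (𝒰.level_le_iwahoriMonoid' hv red hbc hred) (𝒰.lowChar_eq_one_of_mem_level hv red hbc hred m) i).hom.hom ∘ₗ
      (pushforwardCohomology ι (iwahoriMonoid K v red) (symPowCoeff K v red m) (lowChar K v red m)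
        (𝒰.level b c) (coeffX₁ S m) (coeffX₁_comp_symPowCoeff m) i).hom) ∘ₗ
      heckeCohomology ι (iwahoriMonoid K v red) (symPowCoeff K v red m) (𝒰.level b c)
        (𝒰.level_le_iwahoriMonoid' hv red hbc hred) hα i =
      ArithmeticQuotient.heckeEnd S (𝒰.level b c) α S ι i ∘ₗ
        ((cohomologyIso ι (iwahoriMonoid K v red) (lowChar K v red m) (𝒰.level b c)
          (𝒰.level_le_iwahoriMonoid' hv red hbc hred) (𝒰.lowChar_eq_one_of_mem_level hv red hbc hred m) i).hom.hom ∘ₗ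
        (pushforwardCohomology ι (iwahoriMonoid K v red) (symPowCoeff K v red m) (lowChar K v red m)
          (𝒰.level b c) (coeffX₁ S m) (coeffX₁_comp_symPowCoeff m) i).hom) := by
  rw [LinearMap.comp_assoc, heckeCohomology_comp_pushforwardCohomology ι _ _ _ _ _ _
    (𝒰.level_le_iwahoriMonoid' hv red hbc hred) hα i, ← LinearMap.comp_assoc,
    𝒰.level_heckeCohomology_comp_of_localComponent_eq_one hv red hbc hred ι m i hα h1, LinearMap.comp_assoc]

/-- **The diamonds at `v` act with the slot-`1` twist**: for `α = ⟨u⟩_v`,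
`Φ_* ∘ [U α U] = (χ_m(α))_* ∘ heckeEnd α ∘ Φ_*` with `χ_m(α) = red(u₁)^m`
(`lowChar_diamondElement_apply`). [cite: KhareThorne2017, §6.4] -/
theorem level_heckeCohomology_comp_diamondElement (u : Fin 2 → (v.adicCompletionIntegers K)ˣ) :
    (cohomologyIso ι (iwahoriMonoid K v red) (lowChar K v red m) (𝒰.level b c)
        (𝒰.level_le_iwahoriMonoid' hv red hbc hred) (𝒰.lowChar_eq_one_of_mem_level hv red hbc hred m) i).hom.hom ∘ₗ
      heckeCohomology ι (iwahoriMonoid K v red) (lowChar K v red m) (𝒰.level b c)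
        (𝒰.level_le_iwahoriMonoid' hv red hbc hred) (diamondElement_mem_iwahoriMonoid red u) i =
      ((ArithmeticQuotient.cohomologyCoeffMap ι (𝒰.level b c)
          (lowChar K v red m ⟨diamondElement 2 K v u, diamondElement_mem_iwahoriMonoid red u⟩) i).hom ∘ₗ
        ArithmeticQuotient.heckeEnd S (𝒰.level b c) (diamondElement 2 K v u) S ι i) ∘ₗ
        (cohomologyIso ι (iwahoriMonoid K v red) (lowChar K v red m) (𝒰.level b c)
          (𝒰.level_le_iwahoriMonoid' hv red hbc hred) (𝒰.lowChar_eq_one_of_mem_level hv red hbc hred m) i).hom.hom :=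
  heckeCohomology_comp_cohomologyIso_hom ι _ _ (diamondElement_mem_iwahoriMonoid red u) (fun _ hy hyd =>
    lowChar_eq_of_mem_doubleCosetQuot red m _ (𝒰.lowChar_eq_one_of_mem_level hv red hbc hred m)
      (diamondElement_mem_iwahoriMonoid red u) hy hyd) i

end TameLevel

end BigHeckeGLn

end Literature.NumberTheory.Automorphic
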